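import Mathlib
import Summits.Ventures.PercRepro2.Defs
import Summits.Ventures.PercRepro2.Harris
import Summits.Ventures.PercRepro2.CoinDefs
import Summits.Ventures.PercRepro2.CoinArcsOff
import Summits.Ventures.PercRepro2.CoinPendantDefs
import Summits.Ventures.PercRepro2.CoinPendant
import Summits.Ventures.PercRepro2.CoinInduced
import Summits.Ventures.PercRepro2.CoinVdBK
import Summits.Ventures.PercRepro2.CoinBHK
import Summits.Ventures.PercRepro2.CoinReverse
import Summits.Ventures.PercRepro2.CoinTwoPendantDefs
import Summits.Ventures.PercRepro2.CoinTwoPendantMass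

/-!
# The positive-association inputs of the two-vertex pendant head (blind cell PercRepro2,
night-2 g3; proofs/NIGHT2-DARC.md §16)

`trace_bhk` (directed BHK for the backward cluster `K⁻` in the T-frame, `CoinReverse.lean`) in
MASS form on the four traces `∅, {v}, {w}, {w, v}` of `K⁻` on `P = {w, v}`, through the tower
identity `twoPendant_tower`: for monotone nonnegative functionals `g₁, g₂` of the trace and
`μ_Z = ℓ_Z P_Z`,
* `twoPendant_pa`: `(Σ_Z g₁(Z) μ_Z)(Σ_Z g₂(Z) μ_Z) ≤ (Σ_Z (g₁g₂)(Z) μ_Z)(Σ_Z μ_Z)` on `R_T`;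
* `twoPendant_pa_w`: the same on `R_T ∩ {w ∉ K⁻}` (traces `∅, {v}` only).
Also: the levels have total mass `1` (`twoPendant_levels_sum`), hence `P(R_T) = Σ ℓ_Z P_Z > 0`
once the reduced events are non-degenerate (`twoPendant_lambda_pos`), and the two `Finset`
identities `{u, w, t} ∩ {w, v, t} = {w, t}`, `{u, w, t} ∪ {w, v, t} = {u, w, v, t}` feeding
`vdBKC`.  Used by `CoinTwoPendant.lean`.
-/

namespace Summit.Ventures.PercRepro2.Coin

section PA

open Classical

variable {V : Type*} {E : Type*} [Fintype V] [DecidableEq V] [Fintype E] [DecidableEq E]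
  {R : Type*} [Field R] [LinearOrder R] [IsStrictOrderedRing R]

/-- **(AV-PA) of the trace law on `R_T`**, mass form: for monotone nonnegative `g₁, g₂ : Set V → R`
and `μ_Z = ℓ_Z · P_Z`, `(Σ_Z g₁(Z) μ_Z)(Σ_Z g₂(Z) μ_Z) ≤ (Σ_Z (g₁g₂)(Z) μ_Z)(Σ_Z μ_Z)`
(`trace_bhk` with `U = ∅` + the tower identity). -/
lemma twoPendant_pa (p : E → R) (hp : IsProbVec p) {arcs : E → Finset (V × V)}
    (hS : SameEnds arcs) {w v t : V} (hclosed : ClosedOut arcs {w, v} {t})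
    (hT : TailCoinsIn arcs {w, v} {t}) (hwv : w ≠ v) (s : V) {g₁ g₂ : Set V → R}
    (h₁ : Monotone g₁) (h₂ : Monotone g₂) (h₁0 : ∀ S, 0 ≤ g₁ S) (h₂0 : ∀ S, 0 ≤ g₂ S) :
    (g₁ ∅ * (prob p (lvl₀ arcs {t} w v) *
          prob p (avoidEvent (arcsOff arcs ({w, v} ∪ {t})) s {t}))
      + g₁ {v} * (prob p (lvl₁ arcs {t} w v) *
          prob p (avoidEvent (arcsOff arcs ({w, v} ∪ {t})) s (insert v {t})))
      + g₁ {w} * (prob p (lvl₂ arcs {t} w v) *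
          prob p (avoidEvent (arcsOff arcs ({w, v} ∪ {t})) s (insert w {t})))
      + g₁ {w, v} * (prob p (lvl₃ arcs {t} w v) *
          prob p (avoidEvent (arcsOff arcs ({w, v} ∪ {t})) s (insert w (insert v {t})))))
    * (g₂ ∅ * (prob p (lvl₀ arcs {t} w v) *
          prob p (avoidEvent (arcsOff arcs ({w, v} ∪ {t})) s {t}))
      + g₂ {v} * (prob p (lvl₁ arcs {t} w v) *
          prob p (avoidEvent (arcsOff arcs ({w, v} ∪ {t})) s (insert v {t})))
      + g₂ {w} * (prob p (lvl₂ arcs {t} w v) *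
          prob p (avoidEvent (arcsOff arcs ({w, v} ∪ {t})) s (insert w {t})))
      + g₂ {w, v} * (prob p (lvl₃ arcs {t} w v) *
          prob p (avoidEvent (arcsOff arcs ({w, v} ∪ {t})) s (insert w (insert v {t}))))) ≤
    (g₁ ∅ * g₂ ∅ * (prob p (lvl₀ arcs {t} w v) *
          prob p (avoidEvent (arcsOff arcs ({w, v} ∪ {t})) s {t}))
      + g₁ {v} * g₂ {v} * (prob p (lvl₁ arcs {t} w v) *
          prob p (avoidEvent (arcsOff arcs ({w, v} ∪ {t})) s (insert v {t})))
      + g₁ {w} * g₂ {w} * (prob p (lvl₂ arcs {t} w v) *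
          prob p (avoidEvent (arcsOff arcs ({w, v} ∪ {t})) s (insert w {t})))
      + g₁ {w, v} * g₂ {w, v} * (prob p (lvl₃ arcs {t} w v) *
          prob p (avoidEvent (arcsOff arcs ({w, v} ∪ {t})) s (insert w (insert v {t})))))
    * (prob p (lvl₀ arcs {t} w v) * prob p (avoidEvent (arcsOff arcs ({w, v} ∪ {t})) s {t})
      + prob p (lvl₁ arcs {t} w v) *
          prob p (avoidEvent (arcsOff arcs ({w, v} ∪ {t})) s (insert v {t}))
      + prob p (lvl₂ arcs {t} w v) *
          prob p (avoidEvent (arcsOff arcs ({w, v} ∪ {t})) s (insert w {t}))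
      + prob p (lvl₃ arcs {t} w v) *
          prob p (avoidEvent (arcsOff arcs ({w, v} ∪ {t})) s (insert w (insert v {t})))) := by
  have h := trace_bhk p hp hS t s ∅ ({w, v} : Set V) h₁ h₂ h₁0 h₂0
  rw [expect_mul_indicator_one, expect_mul_indicator_one, expect_mul_indicator_one, avoid_s_eq,
    prob_eq_massE_one] at h
  rw [(twoPendant_tower p hclosed hT hwv s g₁).1, (twoPendant_tower p hclosed hT hwv s g₂).1,
    (twoPendant_tower p hclosed hT hwv s (fun S => g₁ S * g₂ S)).1,
    (twoPendant_tower p hclosed hT hwv s (fun _ => 1)).1] at h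
  simpa only [one_mul] using h

/-- **(AV-PA) of the trace law on `R_T ∩ {w ∉ K⁻}`** (the two `w`-free traces), mass form
(`trace_bhk` with `U = {w}` + the tower identity). -/
lemma twoPendant_pa_w (p : E → R) (hp : IsProbVec p) {arcs : E → Finset (V × V)}
    (hS : SameEnds arcs) {w v t : V} (hclosed : ClosedOut arcs {w, v} {t})
    (hT : TailCoinsIn arcs {w, v} {t}) (hwv : w ≠ v) (s : V) {g₁ g₂ : Set V → R}
    (h₁ : Monotone g₁) (h₂ : Monotone g₂) (h₁0 : ∀ S, 0 ≤ g₁ S) (h₂0 : ∀ S, 0 ≤ g₂ S) :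
    (g₁ ∅ * (prob p (lvl₀ arcs {t} w v) *
          prob p (avoidEvent (arcsOff arcs ({w, v} ∪ {t})) s {t}))
      + g₁ {v} * (prob p (lvl₁ arcs {t} w v) *
          prob p (avoidEvent (arcsOff arcs ({w, v} ∪ {t})) s (insert v {t}))))
    * (g₂ ∅ * (prob p (lvl₀ arcs {t} w v) *
          prob p (avoidEvent (arcsOff arcs ({w, v} ∪ {t})) s {t}))
      + g₂ {v} * (prob p (lvl₁ arcs {t} w v) *
          prob p (avoidEvent (arcsOff arcs ({w, v} ∪ {t})) s (insert v {t})))) ≤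
    (g₁ ∅ * g₂ ∅ * (prob p (lvl₀ arcs {t} w v) *
          prob p (avoidEvent (arcsOff arcs ({w, v} ∪ {t})) s {t}))
      + g₁ {v} * g₂ {v} * (prob p (lvl₁ arcs {t} w v) *
          prob p (avoidEvent (arcsOff arcs ({w, v} ∪ {t})) s (insert v {t}))))
    * (prob p (lvl₀ arcs {t} w v) * prob p (avoidEvent (arcsOff arcs ({w, v} ∪ {t})) s {t})
      + prob p (lvl₁ arcs {t} w v) *
          prob p (avoidEvent (arcsOff arcs ({w, v} ∪ {t})) s (insert v {t}))) := by
  have h := trace_bhk p hp hS t s {w} ({w, v} : Set V) h₁ h₂ h₁0 h₂0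
  rw [expect_mul_indicator_one, expect_mul_indicator_one, expect_mul_indicator_one, avoid_sw_eq,
    prob_eq_massE_one] at h
  rw [(twoPendant_tower p hclosed hT hwv s g₁).2, (twoPendant_tower p hclosed hT hwv s g₂).2,
    (twoPendant_tower p hclosed hT hwv s (fun S => g₁ S * g₂ S)).2,
    (twoPendant_tower p hclosed hT hwv s (fun _ => 1)).2] at h
  simpa only [one_mul] using h

omit [Fintype V] [DecidableEq V] [LinearOrder R] [IsStrictOrderedRing R] in
/-- The four levels have total mass `1`. -/
lemma twoPendant_levels_sum (p : E → R) (arcs : E → Finset (V × V)) (w v t : V) :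
    prob p (lvl₀ arcs {t} w v) + prob p (lvl₁ arcs {t} w v) + prob p (lvl₂ arcs {t} w v)
      + prob p (lvl₃ arcs {t} w v) = 1 := by
  have h₀₁ := prob_inter_add_prob_inter_compl p (bwdEvent arcs w {t})ᶜ (bwdEvent arcs v {t})
  have h₂₃ := prob_inter_add_prob_inter_compl p (bwdEvent arcs w {t}) (bwdEvent arcs v {t})
  have hc := prob_compl p (bwdEvent arcs w {t})
  unfold lvl₀ lvl₁ lvl₂ lvl₃
  linear_combination h₀₁ + h₂₃ + hc

omit [Fintype V] [DecidableEq V] in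
/-- `P(R_T) = Σ_i ℓ_i P_i` is positive once the reduced avoidance events are non-degenerate
(`Σ ℓ_i = 1`). -/
lemma twoPendant_lambda_pos (p : E → R) (hp : IsProbVec p) (arcs : E → Finset (V × V))
    (w v t : V) {P₀ P₁ P₂ P₃ : R} (hP₀ : 0 < P₀) (hP₁ : 0 < P₁) (hP₂ : 0 < P₂) (hP₃ : 0 < P₃) :
    0 < prob p (lvl₀ arcs {t} w v) * P₀ + prob p (lvl₁ arcs {t} w v) * P₁
      + prob p (lvl₂ arcs {t} w v) * P₂ + prob p (lvl₃ arcs {t} w v) * P₃ := by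
  have hsum := twoPendant_levels_sum p arcs w v t
  have hℓ₀ := prob_nonneg hp (lvl₀ arcs {t} w v)
  have hℓ₁ := prob_nonneg hp (lvl₁ arcs {t} w v)
  have hℓ₂ := prob_nonneg hp (lvl₂ arcs {t} w v)
  have hℓ₃ := prob_nonneg hp (lvl₃ arcs {t} w v)
  obtain ⟨m, hm⟩ : ∃ m : R, m = min (min P₀ P₁) (min P₂ P₃) := ⟨_, rfl⟩
  have hmpos : 0 < m := by rw [hm]; exact lt_min (lt_min hP₀ hP₁) (lt_min hP₂ hP₃)
  have hm₀ : m ≤ P₀ := by rw [hm]; exact (min_le_left _ _).trans (min_le_left _ _)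
  have hm₁ : m ≤ P₁ := by rw [hm]; exact (min_le_left _ _).trans (min_le_right _ _)
  have hm₂ : m ≤ P₂ := by rw [hm]; exact (min_le_right _ _).trans (min_le_left _ _)
  have hm₃ : m ≤ P₃ := by rw [hm]; exact (min_le_right _ _).trans (min_le_right _ _)
  have e₀ := mul_le_mul_of_nonneg_left hm₀ hℓ₀
  have e₁ := mul_le_mul_of_nonneg_left hm₁ hℓ₁
  have e₂ := mul_le_mul_of_nonneg_left hm₂ hℓ₂
  have e₃ := mul_le_mul_of_nonneg_left hm₃ hℓ₃
  have etot : prob p (lvl₀ arcs {t} w v) * m + prob p (lvl₁ arcs {t} w v) * m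
      + prob p (lvl₂ arcs {t} w v) * m + prob p (lvl₃ arcs {t} w v) * m = m := by
    linear_combination m * hsum
  linarith

omit [Fintype V] [Fintype E] [DecidableEq E] in
/-- `{u, w, t} ∩ {w, v, t} = {w, t}` for `u ∉ {w, v, t}`. -/
lemma twoPendant_inter_eq {u w v t : V} (huw : u ≠ w) (huv : u ≠ v) (hut : u ≠ t) :
    (insert u (insert w {t}) : Finset V) ∩ insert w (insert v {t}) = insert w {t} := by
  ext x
  simp only [Finset.mem_inter, Finset.mem_insert, Finset.mem_singleton]
  constructor
  · rintro ⟨h₁, h₂⟩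
    rcases h₁ with h₁ | h₁ | h₁
    · subst h₁
      rcases h₂ with h | h | h
      · exact absurd h huw
      · exact absurd h huv
      · exact absurd h hut
    · exact Or.inl h₁
    · exact Or.inr h₁
  · rintro (h | h)
    · exact ⟨Or.inr (Or.inl h), Or.inl h⟩
    · exact ⟨Or.inr (Or.inr h), Or.inr (Or.inr h)⟩

omit [Fintype V] [Fintype E] [DecidableEq E] in
/-- `{u, w, t} ∪ {w, v, t} = {u, w, v, t}`. -/
lemma twoPendant_union_eq (u w v t : V) :
    (insert u (insert w {t}) : Finset V) ∪ insert w (insert v {t}) =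
      insert u (insert w (insert v {t})) := by
  ext x
  simp only [Finset.mem_union, Finset.mem_insert, Finset.mem_singleton]
  tauto

end PA

end Summit.Ventures.PercRepro2.Coin
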